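import Summits.Ventures.PercRepro.ProfileThreeMinors
import Summits.Ventures.PercRepro.CoIndepPairsDegree

/-!
# PercRepro — THE ROW `q = 3` OF (Π): THE SINGLE-POINT DELETION STEP AT A POINT WITHOUT SPLIT SETS
(p10, gen 6; `proofs/P10-Q3-NOSPLIT.md`; the minors' bookkeeping is in `ProfileThreeMinors`)

For a finite matroid `M`, a non-loop `z` and a level `u`, call a set `B ⊆ E ∖ z` **`z`-split** if `ρ(B) = 3`,
`u ≤ ρ(E ∖ B)`, `z` is a coloop of `E ∖ B` (deleting `z` lowers the rank of the complement) and `z ∉ cl(B)`.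
`NoSplit M z u` says there is no `z`-split set.  This happens, for instance, when `z` lies on a line with at least
four points of a simple matroid (`ProfileThreeFourLine`): a set `B ∌ z` then either contains two points of
the line (so `z ∈ cl B`) or leaves two of them in `E ∖ B ∖ z` (so `z` is not a coloop of `E ∖ B`).

**Theorem A** (`three_mul_demand_le_of_noSplit`): without `z`-split sets, the rank-3 demand of `M` at level `u`
is paid by the rank-3 demand of `M ∖ z` at level `u` and the rank-2 demand of `M ／ z` at level `u − 1`:

  `3 · D₃(M; u) ≤ 3 · D₃(M ∖ z; u) + u · D₂(M ／ z; u − 1)`,      `D_q(M; u) = Σ_{ρ(B) = q} demand M q u B`.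

Proof.  The rank-3 sets `B' ∋ z` correspond to the rank-2 sets `C = B' ∖ z` of `M ／ z`.  The loss of a rank-3
set `B ∌ z` under the deletion of `z` is nonzero only if `z` is a coloop of `E ∖ B`, and then (no split sets)
`z ∈ cl B`, so `B = C` for `B' = B ∪ z`; attaching that loss to `C` as well, the total demand attached to `C`
is `[u ≤ p'' + 1] · C(p'' + 1, u − 3)` with `p'' = ρ_{M／z}(E ∖ z ∖ C) = ρ(E ∖ C) − 1`, while the `(2, u−1)`-demand
of `C` in `M ／ z` is `[u − 1 ≤ p''] · C(p'', u − 3)`, and `3 · C(p''+1, u−3) ≤ u · C(p'', u−3)` for `p'' ≥ u − 1`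
(`three_mul_choose_succ_le`).

**Corollary** (`profileIneq_three_of_noSplit`): with the tree's row `q = 2` on `M ／ z` (`hallIneq_two_all_direct`)
and the level split `#{ρ(S) = u} = #{ρ_{M∖z}(S) = u} + #{ρ_{M／z}(S) = u − 1}` (`card_levelSet_split`),
`(Π_{3,u})(M ∖ z) ⟹ (Π_{3,u})(M)` for every `u ≥ 4`.

Census (`mining/p10/g6/chk4.c`): on every simple matroid on `≤ 9` elements, every `4 ≤ u ≤ ρ(E)` with
`|E| ≥ u + 4`, every point without split sets satisfies the inequality (1,086,325 points at `|E| = 9`, 0 failures).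

* `NoSplit` — no `z`-split set;
* `three_mul_choose_succ_le`, `three_mul_choose_le_mul` — the arithmetic `3 · C(p+1, k) ≤ (k+3) · C(p, k)`, `p ≥ k + 2`;
* `demand_attached_le` — the per-set bound; `loss_eq_zero`, `sum_loss_le` — the losses reindexed through `z`;
* **`three_mul_demand_le_of_noSplit`** (Theorem A); `profileIneq_two_all'`, `profileIneq_iff_demand`;
  **`profileIneq_three_of_noSplit`**.
-/

open scoped Matroid

namespace PercRepro.Cogirth

open Finset ThmH Skew Shadow Profile

variable {α : Type} [DecidableEq α] {M : Matroid α} [M.Finite]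

/-! ### Split sets -/

/-- **No `z`-split set**: every rank-3 set `B ∌ z` with `u ≤ ρ(E ∖ B)` whose complement loses rank when `z` is
deleted has `z ∈ cl B`. -/
def NoSplit (M : Matroid α) [M.Finite] (z : α) (u : ℕ) : Prop :=
  ∀ B ∈ Rq M 3, z ∉ B → u ≤ rk M (gr M \ B) → rk M ((gr M \ B).erase z) < rk M (gr M \ B) → z ∈ clF M B

/-! ### Arithmetic -/

/-- `3 · C(p+1, k) ≤ (k+3) · C(p, k)` for `p ≥ k + 2`. -/
theorem three_mul_choose_succ_le {p k : ℕ} (h : k + 2 ≤ p) :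
    3 * (p + 1).choose k ≤ (k + 3) * p.choose k := by
  have h1 := Nat.choose_mul_succ_eq p k
  have hpos : 0 < p + 1 - k := by omega
  apply Nat.le_of_mul_le_mul_right _ hpos
  calc 3 * (p + 1).choose k * (p + 1 - k) = 3 * ((p + 1).choose k * (p + 1 - k)) := by ring
    _ = 3 * (p.choose k * (p + 1)) := by rw [← h1]
    _ = p.choose k * (3 * (p + 1)) := by ring
    _ ≤ p.choose k * ((k + 3) * (p + 1 - k)) := by
        apply Nat.mul_le_mul_left
        have : (k + 3) * (p + 1 - k) = (k + 3) * (p + 1) - (k + 3) * k := by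
          rw [Nat.mul_sub]
        rw [this]
        have h2 : (k + 3) * k + 3 * (p + 1) ≤ (k + 3) * (p + 1) := by nlinarith
        omega
    _ = (k + 3) * p.choose k * (p + 1 - k) := by ring

/-- The key bound: for `u ≥ 3` and `u − 1 ≤ p`, `3 · C(p+1, u−3) ≤ u · C(p, u−3)`. -/
theorem three_mul_choose_le_mul {u p : ℕ} (hu : 3 ≤ u) (hp : u - 1 ≤ p) :
    3 * (p + 1).choose (u - 3) ≤ u * p.choose (u - 3) := by
  have h := three_mul_choose_succ_le (p := p) (k := u - 3) (by omega)
  have : u - 3 + 3 = u := by omega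
  rw [this] at h
  exact h

/-- **The per-set bound**: for a rank-3 set `B' ∋ z` and `C = B' ∖ z`, three times the demand of `B'` in `M`
plus three times the loss of `C` under the deletion of `z` is at most `u` times the `(2, u−1)`-demand of `C` in
`M ／ z`. -/
theorem demand_attached_le {z : α} (hz : M.Indep {z}) {u : ℕ} (hu : 3 ≤ u) {B' : Finset α}
    (hzB' : z ∈ B') :
    3 * (demand M 3 u B' + (demand M 3 u (B'.erase z) - demand (M ＼ ({z} : Set α)) 3 u (B'.erase z))) ≤
      u * demand (M ／ ({z} : Set α)) 2 (u - 1) (B'.erase z) := by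
  rw [demand_contract_erase hz u hzB', demand_delete_eq_ite', sdiff_erase_erase_eq hzB']
  unfold demand
  set P := rk M (gr M \ B'.erase z) with hP
  set r := rk M (gr M \ B') with hr
  have hrP : r ≤ P := rk_mono_sub (sdiff_subset_sdiff (subset_refl _) (erase_subset z B'))
  -- the attached demand is at most `[u ≤ P] · C(P, u−3)`
  have hatt : demand M 3 u B' + ((if u ≤ P then P.choose (u - 3) else 0) -
      (if u ≤ r then r.choose (u - 3) else 0)) ≤ if u ≤ P then P.choose (u - 3) else 0 := by
    unfold demand
    rw [← hr]
    split_ifs with h1 h2 h2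
    · have : r.choose (u - 3) ≤ P.choose (u - 3) := Nat.choose_le_choose _ hrP
      omega
    · omega
    · omega
    · omega
  refine le_trans (Nat.mul_le_mul_left 3 hatt) ?_
  split_ifs with h1 h2
  · have hP1 : P = (P - 1) + 1 := by omega
    rw [hP1]
    simp only [Nat.add_sub_cancel]
    exact three_mul_choose_le_mul hu (by omega)
  · omega
  · exact Nat.zero_le _
  · exact Nat.zero_le _

/-- The loss of a set `B ∌ z` under the deletion of `z` is zero unless `u ≤ ρ(E ∖ B)` and `z` is a coloop of
`E ∖ B`. -/
theorem loss_eq_zero {z : α} {u : ℕ} {B : Finset α}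
    (h : ¬ (u ≤ rk M (gr M \ B) ∧ rk M ((gr M \ B).erase z) < rk M (gr M \ B))) :
    demand M 3 u B - demand (M ＼ ({z} : Set α)) 3 u B = 0 := by
  rw [demand_delete_eq_ite']
  unfold demand
  have hle : rk M ((gr M \ B).erase z) ≤ rk M (gr M \ B) := rk_mono_sub (erase_subset z _)
  by_cases h1 : u ≤ rk M (gr M \ B)
  · have heq : rk M ((gr M \ B).erase z) = rk M (gr M \ B) := by
      by_contra hne
      exact h ⟨h1, lt_of_le_of_ne hle hne⟩
    rw [heq, if_pos h1, Nat.sub_self]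
  · rw [if_neg h1, Nat.zero_sub]

/-- **The losses of the sets avoiding `z` are dominated by the losses attached to the sets through `z`** (no
split sets): `Σ_{B ∈ R₃, z ∉ B} loss(B) ≤ Σ_{B' ∈ R₃, z ∈ B'} loss(B' ∖ z)`. -/
theorem sum_loss_le {z : α} (hz : M.Indep {z}) {u : ℕ} (hns : NoSplit M z u) :
    ∑ B ∈ (Rq M 3).filter (fun B => z ∉ B), (demand M 3 u B - demand (M ＼ ({z} : Set α)) 3 u B) ≤
      ∑ B' ∈ (Rq M 3).filter (fun B => z ∈ B),
        (demand M 3 u (B'.erase z) - demand (M ＼ ({z} : Set α)) 3 u (B'.erase z)) := by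
  have hzE : z ∈ gr M := mem_gr_of_indep hz
  set loss : Finset α → ℕ := fun B => demand M 3 u B - demand (M ＼ ({z} : Set α)) 3 u B with hloss
  set s := (Rq M 3).filter (fun B => z ∉ B) with hs
  set t := (Rq M 3).filter (fun B => z ∈ B) with ht
  -- restrict to the sets with positive loss
  have h1 : ∑ B ∈ s, loss B = ∑ B ∈ s.filter (fun B => loss B ≠ 0), loss B := by
    rw [sum_filter_ne_zero]
  -- the image under `insert z` lies in `t`
  have hmaps : ∀ B ∈ s.filter (fun B => loss B ≠ 0), insert z B ∈ t := by
    intro B hB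
    rw [mem_filter, hs, mem_filter] at hB
    obtain ⟨⟨hBR, hzB⟩, hl⟩ := hB
    have hcond : u ≤ rk M (gr M \ B) ∧ rk M ((gr M \ B).erase z) < rk M (gr M \ B) := by
      by_contra hc
      exact hl (loss_eq_zero hc)
    have hcl : z ∈ clF M B := hns B hBR hzB hcond.1 hcond.2
    have hBg : B ⊆ gr M := (mem_Rq.1 hBR).1
    rw [ht, mem_filter, mem_Rq]
    refine ⟨⟨insert_subset hzE hBg, ?_⟩, mem_insert_self _ _⟩
    have h3 : rk M B = 3 := by unfold rk; rw [(mem_Rq.1 hBR).2, ENat.toNat_coe]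
    rw [← coe_rk, rk_insert_eq hzE hBg, if_pos hcl, h3]
  have hinj : Set.InjOn (fun B => insert z B) ((s.filter (fun B => loss B ≠ 0)) : Set (Finset α)) := by
    intro B hB B' hB' heq
    simp only [coe_filter, Set.mem_setOf_eq, hs, mem_filter] at hB hB'
    have hzB : z ∉ B := hB.1.2
    have hzB' : z ∉ B' := hB'.1.2
    have := congrArg (fun X => X.erase z) heq
    simp only [erase_insert hzB, erase_insert hzB'] at this
    exact this
  calc ∑ B ∈ s, loss B = ∑ B ∈ s.filter (fun B => loss B ≠ 0), loss B := h1
    _ = ∑ B' ∈ (s.filter (fun B => loss B ≠ 0)).image (fun B => insert z B), loss (B'.erase z) := by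
        rw [sum_image hinj]
        apply sum_congr rfl
        intro B hB
        rw [mem_filter, hs, mem_filter] at hB
        rw [erase_insert hB.1.2]
    _ ≤ ∑ B' ∈ t, loss (B'.erase z) := by
        apply sum_le_sum_of_subset_of_nonneg
        · intro B' hB'
          rw [mem_image] at hB'
          obtain ⟨B, hB, rfl⟩ := hB'
          exact hmaps B hB
        · intros; exact Nat.zero_le _

/-- **THEOREM A (the per-point deletion step without split sets).**  For a non-loop `z` of a finite matroid `M`
without `z`-split sets at level `u ≥ 3`:
`3 · Σ_{ρ(B)=3} demand_M(B) ≤ 3 · Σ_{ρ_{M∖z}(B)=3} demand_{M∖z}(B) + u · Σ_{ρ_{M／z}(C)=2} demand_{M／z}(C; u−1)`. -/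
theorem three_mul_demand_le_of_noSplit {z : α} (hz : M.Indep {z}) {u : ℕ} (hu : 3 ≤ u)
    (hns : NoSplit M z u) :
    3 * ∑ B ∈ Rq M 3, demand M 3 u B ≤
      3 * ∑ B ∈ Rq (M ＼ ({z} : Set α)) 3, demand (M ＼ ({z} : Set α)) 3 u B +
        u * ∑ C ∈ Rq (M ／ ({z} : Set α)) 2, demand (M ／ ({z} : Set α)) 2 (u - 1) C := by
  -- split the rank-3 sets of `M` by `z ∉ B` / `z ∈ B`
  have hsplit : ∑ B ∈ Rq M 3, demand M 3 u B =
      ∑ B ∈ (Rq M 3).filter (fun B => z ∉ B), demand M 3 u B +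
        ∑ B ∈ (Rq M 3).filter (fun B => z ∈ B), demand M 3 u B := by
    rw [← sum_filter_add_sum_filter_not (Rq M 3) (fun B => z ∉ B)]
    congr 1
    apply sum_congr _ (fun _ _ => rfl)
    ext B; simp only [mem_filter, not_not]
  -- the sets avoiding `z`: demand in `M` = demand in `M ∖ z` + loss
  have hdel : ∑ B ∈ (Rq M 3).filter (fun B => z ∉ B), demand M 3 u B =
      ∑ B ∈ Rq (M ＼ ({z} : Set α)) 3, demand (M ＼ ({z} : Set α)) 3 u B +
        ∑ B ∈ (Rq M 3).filter (fun B => z ∉ B), (demand M 3 u B - demand (M ＼ ({z} : Set α)) 3 u B) := by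
    rw [Rq_delete_eq_filter, ← sum_add_distrib]
    apply sum_congr rfl
    intro B _
    have := demand_delete_le (M := M) 3 u B z
    omega
  -- the contraction side, reindexed by the rank-3 sets through `z`
  rw [sum_Rq_contract_two hz, hsplit, hdel]
  have hterm := fun B' (hB' : B' ∈ (Rq M 3).filter (fun B => z ∈ B)) =>
    demand_attached_le hz hu (mem_filter.1 hB').2
  have hsum := sum_le_sum hterm
  rw [← mul_sum, ← mul_sum, sum_add_distrib] at hsum
  have hloss := sum_loss_le hz hns
  nlinarith [hsum, hloss]

/-! ### The corollaries -/

/-- `(Π_{2,u})` for every finite matroid and every `u > 2` (the tree's Hall form, family = all rank-2 sets). -/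
theorem profileIneq_two_all' (N : Matroid α) [N.Finite] {u : ℕ} (hu : 2 < u) : ProfileIneq N 2 u :=
  hallIneq_two_all_direct hu N (Rq N 2) (subset_refl _) |>.trans
    (by exact_mod_cast card_le_card (filter_subset _ _))

/-- The demand form of a row: `Σ demand ≤ C(u,q) · #levelSet` ↔ `(Π_{q,u})`. -/
theorem profileIneq_iff_demand (q u : ℕ) (hqu : q ≤ u) (hpos : 0 < u.choose q) :
    ProfileIneq M q u ↔ ∑ B ∈ Rq M q, demand M q u B ≤ u.choose q * (levelSet M u).card := by
  unfold ProfileIneq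
  have h : ∑ B ∈ Rq M q, (demand M q u B : ℚ) = (u.choose q : ℚ) * ∑ B ∈ Rq M q, price M q u B := by
    rw [mul_sum]
    apply sum_congr rfl
    intro B _
    rw [choose_mul_price_eq_demand q u hqu B]
  have hc : (0 : ℚ) < u.choose q := by exact_mod_cast hpos
  constructor
  · intro hle
    have : (∑ B ∈ Rq M q, (demand M q u B : ℚ)) ≤ (u.choose q : ℚ) * (levelSet M u).card := by
      rw [h]
      exact mul_le_mul_of_nonneg_left hle hc.le
    exact_mod_cast this
  · intro hle
    have hle' : (∑ B ∈ Rq M q, (demand M q u B : ℚ)) ≤ (u.choose q : ℚ) * (levelSet M u).card := by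
      exact_mod_cast hle
    rw [h] at hle'
    exact le_of_mul_le_mul_left hle' hc

/-- **COROLLARY (the row `q = 3` lifts over a point without split sets).**  For a non-loop `z` with no `z`-split
set at level `u ≥ 4`: `(Π_{3,u})(M ∖ z) ⟹ (Π_{3,u})(M)`. -/
theorem profileIneq_three_of_noSplit {z : α} (hz : M.Indep {z}) {u : ℕ} (hu : 4 ≤ u) (hns : NoSplit M z u)
    (hdel : ProfileIneq (M ＼ ({z} : Set α)) 3 u) : ProfileIneq M 3 u := by
  have hpos : 0 < u.choose 3 := Nat.choose_pos (by omega)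
  have hpos2 : 0 < (u - 1).choose 2 := Nat.choose_pos (by omega)
  rw [profileIneq_iff_demand 3 u (by omega) hpos]
  rw [profileIneq_iff_demand 3 u (by omega) hpos] at hdel
  have hcon := (profileIneq_iff_demand 2 (u - 1) (by omega) hpos2).1
    (profileIneq_two_all' (M ／ ({z} : Set α)) (by omega))
  have hA := three_mul_demand_le_of_noSplit hz (by omega) hns
  have hlev := card_levelSet_split hz (u := u) (by omega)
  -- `u · C(u−1, 2) = 3 · C(u, 3)`
  have hch : u * (u - 1).choose 2 = 3 * u.choose 3 := by
    have h1 : (u - 1 + 1) * (u - 1).choose 2 = (u - 1 + 1).choose (2 + 1) * (2 + 1) :=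
      Nat.add_one_mul_choose_eq (u - 1) 2
    have h2 : u - 1 + 1 = u := by omega
    rw [h2, show (2 : ℕ) + 1 = 3 from rfl] at h1
    omega
  have : 3 * ∑ B ∈ Rq M 3, demand M 3 u B ≤ 3 * (u.choose 3 * (levelSet M u).card) := by
    calc 3 * ∑ B ∈ Rq M 3, demand M 3 u B
        ≤ 3 * ∑ B ∈ Rq (M ＼ ({z} : Set α)) 3, demand (M ＼ ({z} : Set α)) 3 u B +
            u * ∑ C ∈ Rq (M ／ ({z} : Set α)) 2, demand (M ／ ({z} : Set α)) 2 (u - 1) C := hA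
      _ ≤ 3 * (u.choose 3 * (levelSet (M ＼ ({z} : Set α)) u).card) +
            u * ((u - 1).choose 2 * (levelSet (M ／ ({z} : Set α)) (u - 1)).card) := by
          gcongr
      _ = 3 * (u.choose 3 * (levelSet M u).card) := by
          rw [hlev]
          nlinarith [hch]
  omega


end PercRepro.Cogirth
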